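import Literature.IUT.HodgeArakelov.EtaleThetaDataOfSettingCyclotomeKummerRelation

/-!
# [IUTchII] Prop 3.4 (i) / Cor 1.11 (b), binder `hgal` («HCYC-FROM-HGAL»): the cyclotome exponent of an automorphism of
# `l·Δ_Θ` is COMPATIBLE ACROSS LEVELS `M ∣ M'` — the level-shift lemma for part 2

PAGINATION (cell CITE-CONVENTION §F v1.19at-bis): [EtTh] pages below = page index `pNNNN` of the render
`paper:doi-10-2977-prims-1234361159` (Publ. RIMS **45** (2009) journal PDF; printed PRIMS page = index + 226), read on the page by
this seat; [IUTchII] pages = render `book:anonnd-inter-universal-teichmuller-theory-ii` (kurims manuscript).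
S. Mochizuki, *The étale theta function …* [EtTh]: §1 p. 12 l. 62 («`Δ^Θ_X = Δ_X/[Δ_X,[Δ_X,Δ_X]]` … the image of `∧² Δ^ell_X`
`(≅ Ẑ(1))` … `Δ_Θ`»), Def 2.10 p. 44 l. 15 («`μ_N`», «`Δ_{μ_N} = (ℤ/Nℤ)(1)`» l. 8), §2 p. 46 l. 87–88 («the natural isomorphism
`μ_N ≅ (l·Δ_Θ) ⊗ (ℤ/Nℤ)`»), Def 2.13 (ii) pp. 47–48 (p. 48 l. 4–8 «if `N ∣ N'` … `M_{N'}` for the mod `N'` mono-theta environment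
induced by `M`») [cite: MochizukiEtTh2009, Def 2.13 (ii) p.48]; consumer: S. Mochizuki, *Inter-universal Teichmüller theory II*,
Prop 3.4 (i) pp. 91–92 (p. 92 l. 1–8 «… is multiradially defined») [cite: Mochizuki2012, Prop 3.4 (i) p.92] — claim key DISPUTED
(D-0012), nothing of it asserted here.  abc-iut cell,
seat abc-iut-w6-d002 (gen 6); SUPPLIER piece for abc-iut-w5-d169's «HCYC-FROM-HGAL» part 2 (GAP-LEDGER G-w5d169-3), arising
from the RQ7 read AUDIT-p446353 (INFO 1–2): at a single level `M` the classical Kummer–valuation step only gives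
`u_M ≡ χ_cyc(τ) (mod M/gcd(M, e·v_K(q_X)))`; (HCYC) at level `M` follows by running
`exists_cyclotomeExponent_kummer_relation` at level `M' := M·e·v_K(q_X)` and DESCENDING the exponent — which needs exactly
the compatibility proved below.

PROOF-ONLY (no definition, no `Prop`-valued fact, nothing restated; abc-iut-L2 vocabulary `ThetaSetting.CyclotomeMod`
(`red`, `red_surjective`, `red_ker`), `MuN`, `card_MuN` BY NAME):
* `red_zpow_eq_red_zpow_of_dvd` — for `M ∣ M'`, identifications `ν` at level `M` and `ν'` at level `M'` (NOT assumed
  compatible with each other), ANY relation `R` on `l·Δ_Θ` that is total (`∀ z, ∃ w, R z w`) and exponents `u`, `u'` with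
  `R z w → ν.red w = (ν.red z)^u` and `R z w → ν'.red w = (ν'.red z)^{u'}`: `(ν.red z)^u = (ν.red z)^{u'}` for every `z`
  (proof: `w = z^{u'} · y^{M'}` by `ν'.red_ker`, and `ν.red (y^{M'}) = 1` because `M ∣ M'`);
* `muN_zpow_eq_zpow_of_dvd` — hence `ζ^u = ζ^{u'}` for every `ζ ∈ μ_M` (`ν.red` onto);
* `dvd_sub_exponent_of_dvd` — hence `(M : ℤ) ∣ u' − u` (`μ_M` has an element of order `M`);
* `dvd_sub_of_levelShift` — the level-shift recipe: `M' = M·n`, `M' ∣ (u' − c)·n` (valuation step at level `M'`) ⟹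
  `M ∣ u − c` at level `M`;
* `rangeAut_exponent_dvd_sub_of_dvd` — the same packaged at the shape of abc-iut-w5-d169's `exists_exponent_of_rangeAut`:
  two exponents of ONE automorphism `β` of `φ(Π^tp_{X̲̲})` stabilising `l·Δ_Θ`, read at levels `M ∣ M'`, agree `mod M`.
No side taken on [IUTchIII] Cor 3.12; typed ≠ proved for the consumer's binders; here everything is proved (elementary).
-/

noncomputable section

namespace Literature.IUT.HodgeArakelov

namespace EtaleThetaDataOfSetting

open Literature.AnabelianGeometry.EtaleTheta Literature.AnabelianGeometry.SemiGraphs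

variable {p : ℕ} [Fact p.Prime] {D : Literature.AnabelianGeometry.EtaleTheta.ThetaSetting p} {l : ℕ}

/-! ### 1. Exponents of one map read at two levels `M ∣ M'` -/

section Levels

variable {M M' : ℕ+}

/-- An `M'`-th power of `l·Δ_Θ` reduces to `1` in `μ_M` when `M ∣ M'`. [cite: MochizukiEtTh2009, Def 2.13 (ii) p.48] -/
theorem red_pow_eq_one_of_dvd (h : (M : ℕ) ∣ M') (ν : D.CyclotomeMod l M) (y : D.lDeltaTheta l) :
    ν.red (y ^ ((M' : ℕ+) : ℕ)) = 1 := by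
  obtain ⟨q, hq⟩ := h
  have hM : ν.red y ^ ((M : ℕ+) : ℕ) = 1 := by
    have hc := pow_card_eq_one (G := MuN p M) (x := ν.red y)
    rwa [card_MuN] at hc
  rw [map_pow, hq, pow_mul, hM, one_pow]

/-- **Exponents are compatible across levels.**  Let `M ∣ M'`, `ν`, `ν'` cyclotome identifications at levels `M`, `M'`
(not assumed compatible), `R` a total relation on `l·Δ_Θ` («`w` is the image of `z`» under some fixed map), and `u`, `u'`
exponents of `R` read through `ν`, `ν'`.  Then `(ν.red z)^u = (ν.red z)^{u'}` for every `z`.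
[cite: MochizukiEtTh2009, Def 2.13 (ii) p.48] -/
theorem red_zpow_eq_red_zpow_of_dvd (h : (M : ℕ) ∣ M') (ν : D.CyclotomeMod l M) (ν' : D.CyclotomeMod l M')
    (R : D.lDeltaTheta l → D.lDeltaTheta l → Prop) (hR : ∀ z, ∃ w, R z w)
    {u u' : ℤ} (hu : ∀ z w, R z w → ν.red w = ν.red z ^ u) (hu' : ∀ z w, R z w → ν'.red w = ν'.red z ^ u')
    (z : D.lDeltaTheta l) : ν.red z ^ u = ν.red z ^ u' := by
  obtain ⟨w, hzw⟩ := hR z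
  -- at level `M'`: `w · z^{-u'}` is an `M'`-th power
  have h1 : ν'.red (w * (z ^ u')⁻¹) = 1 := by
    rw [map_mul, map_inv, map_zpow, hu' z w hzw, mul_inv_cancel]
  obtain ⟨y, hy⟩ := (ν'.red_ker _).1 h1
  have hw : w = y ^ ((M' : ℕ+) : ℕ) * z ^ u' := by
    rw [← hy, inv_mul_cancel_right]
  -- read at level `M`
  have h2 : ν.red w = ν.red z ^ u' := by
    rw [hw, map_mul, red_pow_eq_one_of_dvd h ν y, one_mul, map_zpow]
  rw [← hu z w hzw, h2]

/-- Consequently `ζ^u = ζ^{u'}` for EVERY `ζ ∈ μ_M` (`ν.red` is onto). [cite: MochizukiEtTh2009, Def 2.10 p.44] -/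
theorem muN_zpow_eq_zpow_of_dvd (h : (M : ℕ) ∣ M') (ν : D.CyclotomeMod l M) (ν' : D.CyclotomeMod l M')
    (R : D.lDeltaTheta l → D.lDeltaTheta l → Prop) (hR : ∀ z, ∃ w, R z w)
    {u u' : ℤ} (hu : ∀ z w, R z w → ν.red w = ν.red z ^ u) (hu' : ∀ z w, R z w → ν'.red w = ν'.red z ^ u')
    (ζ : MuN p M) : ζ ^ u = ζ ^ u' := by
  obtain ⟨z, rfl⟩ := ν.red_surjective ζ
  exact red_zpow_eq_red_zpow_of_dvd h ν ν' R hR hu hu' z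

/-- Consequently `M ∣ u' − u` (`μ_M` is cyclic of order `M`). [cite: MochizukiEtTh2009, Def 2.10 p.44] -/
theorem dvd_sub_exponent_of_dvd (h : (M : ℕ) ∣ M') (ν : D.CyclotomeMod l M) (ν' : D.CyclotomeMod l M')
    (R : D.lDeltaTheta l → D.lDeltaTheta l → Prop) (hR : ∀ z, ∃ w, R z w)
    {u u' : ℤ} (hu : ∀ z w, R z w → ν.red w = ν.red z ^ u) (hu' : ∀ z w, R z w → ν'.red w = ν'.red z ^ u') :
    ((M : ℕ+) : ℤ) ∣ u' - u := by
  obtain ⟨ζ₀, hζ₀⟩ := IsCyclic.exists_generator (α := MuN p M)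
  have hord : orderOf ζ₀ = ((M : ℕ+) : ℕ) := by
    rw [orderOf_eq_card_of_forall_mem_zpowers hζ₀, Nat.card_eq_fintype_card, card_MuN]
  have h1 : ζ₀ ^ (u' - u) = 1 := by
    rw [zpow_sub, ← muN_zpow_eq_zpow_of_dvd h ν ν' R hR hu hu' ζ₀, mul_inv_cancel]
  have h2 := orderOf_dvd_iff_zpow_eq_one.2 h1
  rwa [hord] at h2

/-- **The level-shift recipe in kernel form** (AUDIT-p446353 INFO 1): if at the SHIFTED level `M' = M·n` (`n ≠ 0`, in the
application `n = e·v_K(q_X)`) the exponent `u'` satisfies the valuation congruence `M' ∣ (u' − c)·n` (what the classical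
Kummer–valuation step yields, `c` = a lift of `χ_cyc(τ)`), then the exponent `u` at level `M` satisfies `M ∣ u − c` EXACTLY.
[cite: MochizukiEtTh2009, Def 2.13 (ii) p.48] -/
theorem dvd_sub_of_levelShift (h : (M : ℕ) ∣ M') (ν : D.CyclotomeMod l M) (ν' : D.CyclotomeMod l M')
    (R : D.lDeltaTheta l → D.lDeltaTheta l → Prop) (hR : ∀ z, ∃ w, R z w)
    {u u' : ℤ} (hu : ∀ z w, R z w → ν.red w = ν.red z ^ u) (hu' : ∀ z w, R z w → ν'.red w = ν'.red z ^ u')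
    {n c : ℤ} (hn : n ≠ 0) (hM' : ((M' : ℕ+) : ℤ) = ((M : ℕ+) : ℤ) * n) (hval : ((M' : ℕ+) : ℤ) ∣ (u' - c) * n) :
    ((M : ℕ+) : ℤ) ∣ u - c := by
  have h1 : ((M : ℕ+) : ℤ) ∣ u' - c := by
    rw [hM'] at hval
    exact Int.dvd_of_mul_dvd_mul_right hn hval
  have h2 : ((M : ℕ+) : ℤ) ∣ u' - u := dvd_sub_exponent_of_dvd h ν ν' R hR hu hu'
  have h3 : u - c = (u' - c) - (u' - u) := by ring
  rw [h3]
  exact dvd_sub h1 h2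

end Levels

/-! ### 2. Packaged at the shape of `exists_exponent_of_rangeAut` -/

section RangeAut

variable {E : D.EtaleThetaData} (C : E.DoubleUnderline l)

/-- **Two exponents of ONE automorphism of `φ(Π^tp_{X̲̲})` stabilising `l·Δ_Θ`, read at levels `M ∣ M'`, agree
`mod M`.**  This is the level-descent needed to turn the `q`-Kummer relation of `exists_cyclotomeExponent_kummer_relation`
at level `M·e·v_K(q_X)` into (HCYC) at level `M`. [cite: Mochizuki2012, Prop 3.4 (i) p.92] -/
theorem rangeAut_exponent_dvd_sub_of_dvd {M M' : ℕ+} (h : (M : ℕ) ∣ M') (ν : D.CyclotomeMod l M)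
    (ν' : D.CyclotomeMod l M') (β : phiRange C ≃* phiRange C)
    (hβ : ∀ t : phiRange C, t ∈ (D.lDeltaTheta l).subgroupOf (phiRange C) ↔
      β t ∈ (D.lDeltaTheta l).subgroupOf (phiRange C))
    {u u' : ℤ}
    (hu : ∀ z w : D.lDeltaTheta l,
      ((β ⟨(z : D.GtpTheta), lDeltaTheta_le_phiRange C z.2⟩ : phiRange C) : D.GtpTheta) = (w : D.GtpTheta) →
        ν.red w = ν.red z ^ u)
    (hu' : ∀ z w : D.lDeltaTheta l,
      ((β ⟨(z : D.GtpTheta), lDeltaTheta_le_phiRange C z.2⟩ : phiRange C) : D.GtpTheta) = (w : D.GtpTheta) →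
        ν'.red w = ν'.red z ^ u') :
    ((M : ℕ+) : ℤ) ∣ u' - u := by
  refine dvd_sub_exponent_of_dvd h ν ν'
    (fun z w => ((β ⟨(z : D.GtpTheta), lDeltaTheta_le_phiRange C z.2⟩ : phiRange C) : D.GtpTheta) = (w : D.GtpTheta))
    (fun z => ?_) hu hu'
  have hmem : ((β ⟨(z : D.GtpTheta), lDeltaTheta_le_phiRange C z.2⟩ : phiRange C) : D.GtpTheta) ∈ D.lDeltaTheta l :=
    (Subgroup.mem_subgroupOf).1 ((hβ _).1 ((Subgroup.mem_subgroupOf).2 z.2))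
  exact ⟨⟨_, hmem⟩, rfl⟩

/-- The `μ_M`-form of the same descent: the two exponents act identically on `μ_M`.
[cite: Mochizuki2012, Prop 3.4 (i) p.92] -/
theorem rangeAut_muN_zpow_eq_of_dvd {M M' : ℕ+} (h : (M : ℕ) ∣ M') (ν : D.CyclotomeMod l M)
    (ν' : D.CyclotomeMod l M') (β : phiRange C ≃* phiRange C)
    (hβ : ∀ t : phiRange C, t ∈ (D.lDeltaTheta l).subgroupOf (phiRange C) ↔
      β t ∈ (D.lDeltaTheta l).subgroupOf (phiRange C))
    {u u' : ℤ}
    (hu : ∀ z w : D.lDeltaTheta l,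
      ((β ⟨(z : D.GtpTheta), lDeltaTheta_le_phiRange C z.2⟩ : phiRange C) : D.GtpTheta) = (w : D.GtpTheta) →
        ν.red w = ν.red z ^ u)
    (hu' : ∀ z w : D.lDeltaTheta l,
      ((β ⟨(z : D.GtpTheta), lDeltaTheta_le_phiRange C z.2⟩ : phiRange C) : D.GtpTheta) = (w : D.GtpTheta) →
        ν'.red w = ν'.red z ^ u')
    (ζ : MuN p M) : ζ ^ u = ζ ^ u' := by
  refine muN_zpow_eq_zpow_of_dvd h ν ν'
    (fun z w => ((β ⟨(z : D.GtpTheta), lDeltaTheta_le_phiRange C z.2⟩ : phiRange C) : D.GtpTheta) = (w : D.GtpTheta))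
    (fun z => ?_) hu hu' ζ
  have hmem : ((β ⟨(z : D.GtpTheta), lDeltaTheta_le_phiRange C z.2⟩ : phiRange C) : D.GtpTheta) ∈ D.lDeltaTheta l :=
    (Subgroup.mem_subgroupOf).1 ((hβ _).1 ((Subgroup.mem_subgroupOf).2 z.2))
  exact ⟨⟨_, hmem⟩, rfl⟩

end RangeAut

end EtaleThetaDataOfSetting

end Literature.IUT.HodgeArakelov

end
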